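import Summits.ABC.ABC.Theorems.IneffectiveSubspaceDepthCountedABCStubCellOneCases
import Summits.ABC.ABC.Theorems.IneffectiveSubspaceDepthCountedABCStubThueMahlerOfCellOneLittleO

/-!
# Stub `stub_cellOneIffUniformQuarticThueMahlerCell` of line `Sketch` — crux `DepthCountedABC` (stmt-ABC-14938)

WHAT.  On the depth cell `#{p : v_p(abc) ≥ 5} ≤ 1` of crux #5 `DepthCountedABC` the first improvement of the free
exponent `4` is EXACTLY the uniform binomial quartic Thue–Mahler statement RESTRICTED TO THE CELL:
`(∃ δ > 0, ∃ C > 0, ∀ abc triples of the cell, c < C·rad(abc)^(4−δ)) ↔ (∃ η > 0`, bounded `Z` over the positive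
coprime solutions of `a + p^k·u = v·Z⁴` whose triple `(a, p^k u, v Z⁴)` lies in the cell and `a·u·v·p ≤ Z^η`, and
bounded `Y` over those of `a + u·Y⁴ = p^w·v` whose triple `(a, u Y⁴, p^w v)` lies in the cell and `a·u·v·p ≤ Y^η`,
`p` prime`)`.  Lead c19's Stub 17 `stub_cellOneOfUniformQuarticThueMahler` gave only `←` from the UNRESTRICTED
Thue–Mahler statement; this certificate closes the pair into an exact equivalence.

MECHANISM.  `→` (`cellOneIffUQTM_bound`, elementary): at `η = δ/8` a datum of either shape IS an abc triple of the
cell with `rad ≤ (a·u·v·p)·X ≤ X^(1+η)` (`X = Z`, resp. `Y`; `rad(p^k u) ≤ p·u`, `rad(vZ⁴) ≤ v·Z`) and `X⁴ ≤ c`, so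
`X⁴ < C·X^((1+η)(4−δ)) = C·X^(4−κ)`, `κ = δ − η(4−δ) > 0`, i.e. `X < C^(1/κ)` (and `X < C` outright if `δ > 4`).
`←` (`cellOneIffUQTM_of_cell`, the proof of Stub 17 with the datum's cell hypothesis supplied by the triple): order
`a ≤ b`; by `stub_cellOneCases` either `c < 2rad²`, or the deep prime sits in `b` (`a + p^k·u = v·Z⁴ = c`,
`a·u·v·p·c⁴ ≤ rad¹⁶`, `c⁴ ≤ rad¹²·Z⁴`) or in `c` (`b = u·Y⁴`, `a + u·Y⁴ = p^w·v = c ≤ 2b`, `a·u·v·p·b⁴ ≤ rad¹⁶`,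
`b⁴ ≤ rad¹²·Y⁴`); on an exceptional triple `c ≥ rad^(4−η'/8)` (`η' = min(η,1)`) with `rad^(3η'/8) ≥ 32` this forces
`a·u·v·p ≤ X^η'` (`cellOneIffUQTM_radius`, both shapes at once), the cell hypothesis of the datum is LITERALLY that
of the triple once `b = p^k·u, c = v·Z⁴` (resp. `b = u·Y⁴, c = p^w·v`) are substituted, so `X ≤ B` and `rad ≤ 4B²`;
with `c ≤ 2rad⁴` (`calibration_one`) every exceptional triple has bounded `c`.

Sources: skeleton `Cruxes/DepthCountedABC/Lines/Sketch.lean` (lead c23, wave 3), stub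
`stub_cellOneIffUniformQuarticThueMahlerCell`; `cellOneIffUQTM_radius` / `cellOneIffUQTM_of_cell` are adapted from
`cellOne_radius_C` / `stub_cellOneOfUniformQuarticThueMahler` of the accepted sibling `…StubCellOneThueMahler` (lead c19),
`cellOneIffUQTM_bound` from `stub_uniformQuarticThueOfCellZero` (`…StubQuarticThueOfCellZero`).  Ingredients (landed,
sorry-free, namespace `Summit.ABC.ABC.Theorems.DepthCountedABC`): `stub_cellOneCases` (`…StubCellOneCases`),
`calibration_one` (`…StubCalibration`), `thueMahlerOfCellOneLittleO_coprime_of_sum`, `…_rad_le_mul₃`,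
`…_radical_prime_pow_mul_le` (`…StubThueMahlerOfCellOneLittleO`), `radical_mul_pow_four_le`, `nat_le_floor_of_lt`
(`…StubQuarticThueWindow`), and Mathlib (`Real.rpow_*`, `le_of_pow_le_pow_left₀`, `le_self_pow₀`).  No unproved facts.
Deliberately NOT here: the cell-0 analogue (`stub_cellZeroIffUniformQuarticThueCell`, landed separately).
-/

-- `Summit.<Summit>.<Problem>` is the mandated summit-side namespace (CONVENTIONS §2); for the
-- single-conjunct summit `ABC` the two coincide, so the duplicate `ABC.ABC` is deliberate.
set_option linter.dupNamespace false

namespace Summit.ABC.ABC.Theorems.DepthCountedABC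

open UniqueFactorizationMonoid (radical)
open Literature.NumberTheory.DiophantineGeometry (IsABCTriple rad rad_def)

/-- Exceptional triples of cell 1, both shapes at once (`X = Z, t = c`, resp. `X = Y, t = b`): from
`a·u·v·p·t⁴ ≤ R¹⁶`, `t⁴ ≤ R¹²·X⁴`, `c ≤ 2t`, `c ≥ R^(4−η/8)` and `R^(3η/8) ≥ 32` one gets `a·u·v·p ≤ 16R^(η/2) ≤ X^η`
and `R^(4−η/2) ≤ 16X⁴`, so a Thue–Mahler bound `a·u·v·p ≤ X^η → X ≤ B` for THIS datum gives `R ≤ 4B²`. [folklore] -/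
theorem cellOneIffUQTM_radius {η : ℝ} {B : ℕ} (hη : 0 < η) (hη1 : η ≤ 1) {a u v p X t c R : ℕ} (hX : 0 < X)
    (hc2t : c ≤ 2 * t) (hN5 : a * u * v * p * t ^ 4 ≤ R ^ 16) (hN6 : t ^ 4 ≤ R ^ 12 * X ^ 4) (hR1 : 1 ≤ R)
    (ht : 0 < t) (hexc : (R : ℝ) ^ (4 - η / 8) ≤ (c : ℝ)) (hbig : (32 : ℝ) ≤ (R : ℝ) ^ (3 * η / 8))
    (hXB : ((a * u * v * p : ℕ) : ℝ) ≤ (X : ℝ) ^ η → X ≤ B) : (R : ℝ) ≤ 4 * (B : ℝ) ^ 2 := by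
  -- adapted from `cellOne_radius_C` (`…StubCellOneThueMahler`): the hypothesis is applied to one datum only
  have hx1 : (1 : ℝ) ≤ (R : ℝ) := by exact_mod_cast hR1
  have hx0 : (0 : ℝ) < (R : ℝ) := by linarith
  have hX0 : (0 : ℝ) ≤ (X : ℝ) := by positivity
  have htpos : (0 : ℝ) < (t : ℝ) := by exact_mod_cast ht
  have hN5R : ((a * u * v * p : ℕ) : ℝ) * (t : ℝ) ^ 4 ≤ (R : ℝ) ^ 16 := by exact_mod_cast hN5
  have hN6R : (t : ℝ) ^ 4 ≤ (R : ℝ) ^ 12 * (X : ℝ) ^ 4 := by exact_mod_cast hN6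
  have hc2tR : (c : ℝ) ≤ 2 * (t : ℝ) := by exact_mod_cast hc2t
  have hexc4 : (R : ℝ) ^ ((4 - η / 8) * 4) ≤ (c : ℝ) ^ 4 := by
    rw [Real.rpow_mul hx0.le, Real.rpow_ofNat]
    exact pow_le_pow_left₀ (Real.rpow_nonneg hx0.le _) hexc 4
  have hct4 : (c : ℝ) ^ 4 ≤ 16 * (t : ℝ) ^ 4 := by
    calc (c : ℝ) ^ 4 ≤ (2 * (t : ℝ)) ^ 4 := pow_le_pow_left₀ (by positivity) hc2tR 4
      _ = 16 * (t : ℝ) ^ 4 := by ring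
  have ht4pos : (0 : ℝ) < (t : ℝ) ^ 4 := by positivity
  have hRt : (R : ℝ) ^ ((4 - η / 8) * 4) ≤ 16 * (t : ℝ) ^ 4 := hexc4.trans hct4
  -- `a u v p ≤ 16 R^(η/2)`
  have hauv : ((a * u * v * p : ℕ) : ℝ) ≤ 16 * (R : ℝ) ^ (η / 2) := by
    have h1 : ((a * u * v * p : ℕ) : ℝ) ≤ (R : ℝ) ^ 16 / (t : ℝ) ^ 4 := by
      rw [le_div_iff₀ ht4pos]; exact hN5R
    have hR16pos : (0 : ℝ) < (R : ℝ) ^ ((4 - η / 8) * 4) / 16 := by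
      have := Real.rpow_pos_of_pos hx0 ((4 - η / 8) * 4); positivity
    have h2 : (R : ℝ) ^ 16 / (t : ℝ) ^ 4 ≤ (R : ℝ) ^ 16 / ((R : ℝ) ^ ((4 - η / 8) * 4) / 16) :=
      div_le_div_of_nonneg_left (by positivity) hR16pos (by linarith)
    have h3 : (R : ℝ) ^ 16 / ((R : ℝ) ^ ((4 - η / 8) * 4) / 16) = 16 * (R : ℝ) ^ (η / 2) := by
      have : (R : ℝ) ^ (16 : ℕ) = (R : ℝ) ^ ((4 - η / 8) * 4) * (R : ℝ) ^ (η / 2) := by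
        rw [← Real.rpow_add hx0]
        have he : (4 - η / 8) * 4 + η / 2 = ((16 : ℕ) : ℝ) := by push_cast; ring
        rw [he, Real.rpow_natCast]
      rw [this]
      have hne : (R : ℝ) ^ ((4 - η / 8) * 4) ≠ 0 := (Real.rpow_pos_of_pos hx0 _).ne'
      field_simp
    exact h1.trans (h2.trans h3.le)
  -- `R^(4 − η/2) ≤ 16 X⁴`
  have hX4 : (R : ℝ) ^ (4 - η / 2) ≤ 16 * (X : ℝ) ^ 4 := by
    have h1 : (R : ℝ) ^ (4 - η / 2) * (R : ℝ) ^ (12 : ℝ) = (R : ℝ) ^ ((4 - η / 8) * 4) := by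
      rw [← Real.rpow_add hx0]; ring_nf
    have hx12 : (0 : ℝ) < (R : ℝ) ^ (12 : ℝ) := Real.rpow_pos_of_pos hx0 _
    have h2 : (R : ℝ) ^ (4 - η / 2) * (R : ℝ) ^ (12 : ℝ) ≤ (16 * (X : ℝ) ^ 4) * (R : ℝ) ^ (12 : ℝ) := by
      calc _ = (R : ℝ) ^ ((4 - η / 8) * 4) := h1
        _ ≤ 16 * (t : ℝ) ^ 4 := hRt
        _ ≤ 16 * ((R : ℝ) ^ 12 * (X : ℝ) ^ 4) := by linarith
        _ = (16 * (X : ℝ) ^ 4) * (R : ℝ) ^ (12 : ℝ) := by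
            rw [← Real.rpow_natCast (R : ℝ) 12]; push_cast; ring
    exact le_of_mul_le_mul_right h2 hx12
  -- step 1: `32 R^(η/2) ≤ R^((4 − η/2)(η/4))`
  have hexp : 3 * η / 8 ≤ (4 - η / 2) * (η / 4) - η / 2 := by nlinarith
  have hstep1 : 32 * (R : ℝ) ^ (η / 2) ≤ (R : ℝ) ^ ((4 - η / 2) * (η / 4)) := by
    have h1 : (32 : ℝ) ≤ (R : ℝ) ^ ((4 - η / 2) * (η / 4) - η / 2) :=
      hbig.trans (Real.rpow_le_rpow_of_exponent_le hx1 hexp)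
    have h2 : (R : ℝ) ^ ((4 - η / 2) * (η / 4) - η / 2) * (R : ℝ) ^ (η / 2) =
        (R : ℝ) ^ ((4 - η / 2) * (η / 4)) := by
      rw [← Real.rpow_add hx0]; ring_nf
    calc 32 * (R : ℝ) ^ (η / 2) ≤ (R : ℝ) ^ ((4 - η / 2) * (η / 4) - η / 2) * (R : ℝ) ^ (η / 2) :=
          mul_le_mul_of_nonneg_right h1 (Real.rpow_nonneg hx0.le _)
      _ = _ := h2
  -- step 2: `R^((4 − η/2)(η/4)) ≤ (16 X⁴)^(η/4) ≤ 2 · X^η`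
  have hstep2 : (R : ℝ) ^ ((4 - η / 2) * (η / 4)) ≤ 2 * (X : ℝ) ^ η := by
    have h1 : ((R : ℝ) ^ (4 - η / 2)) ^ (η / 4) ≤ (16 * (X : ℝ) ^ 4) ^ (η / 4) :=
      Real.rpow_le_rpow (Real.rpow_nonneg hx0.le _) hX4 (by positivity)
    have h2 : ((R : ℝ) ^ (4 - η / 2)) ^ (η / 4) = (R : ℝ) ^ ((4 - η / 2) * (η / 4)) := by
      rw [← Real.rpow_mul hx0.le]
    have h3 : (16 * (X : ℝ) ^ 4) ^ (η / 4) = (16 : ℝ) ^ (η / 4) * (X : ℝ) ^ η := by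
      rw [Real.mul_rpow (by norm_num) (by positivity)]
      congr 1
      rw [← Real.rpow_natCast, ← Real.rpow_mul hX0]; congr 1; push_cast; ring
    have h4 : (16 : ℝ) ^ (η / 4) ≤ 2 := by
      have h16 : (16 : ℝ) = 2 ^ (4 : ℝ) := by norm_num
      calc (16 : ℝ) ^ (η / 4) ≤ (16 : ℝ) ^ ((1 : ℝ) / 4) :=
            Real.rpow_le_rpow_of_exponent_le (by norm_num) (by linarith)
        _ = 2 := by rw [h16, ← Real.rpow_mul (by norm_num)]; norm_num
    calc (R : ℝ) ^ ((4 - η / 2) * (η / 4)) = ((R : ℝ) ^ (4 - η / 2)) ^ (η / 4) := h2.symm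
      _ ≤ (16 * (X : ℝ) ^ 4) ^ (η / 4) := h1
      _ = (16 : ℝ) ^ (η / 4) * (X : ℝ) ^ η := h3
      _ ≤ 2 * (X : ℝ) ^ η := mul_le_mul_of_nonneg_right h4 (Real.rpow_nonneg hX0 _)
  have hXB' : X ≤ B := hXB (by linarith [hauv, hstep1, hstep2])
  have hR2 : (R : ℝ) ^ (2 : ℕ) ≤ (4 * (B : ℝ) ^ 2) ^ (2 : ℕ) := by
    have h1 : (R : ℝ) ^ ((2 : ℕ) : ℝ) ≤ (R : ℝ) ^ (4 - η / 2) :=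
      Real.rpow_le_rpow_of_exponent_le hx1 (by push_cast; linarith)
    have h2 : (X : ℝ) ^ 4 ≤ (B : ℝ) ^ 4 := by exact_mod_cast Nat.pow_le_pow_left hXB' 4
    calc (R : ℝ) ^ (2 : ℕ) = (R : ℝ) ^ ((2 : ℕ) : ℝ) := (Real.rpow_natCast _ 2).symm
      _ ≤ (R : ℝ) ^ (4 - η / 2) := h1
      _ ≤ 16 * (X : ℝ) ^ 4 := hX4
      _ ≤ 16 * (B : ℝ) ^ 4 := by linarith
      _ = (4 * (B : ℝ) ^ 2) ^ (2 : ℕ) := by ring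
  exact le_of_pow_le_pow_left₀ two_ne_zero (by positivity) hR2

/-- **The `←` half:** uniform binomial quartic Thue–Mahler ON THE CELL (both shapes, some `η > 0`) gives abc on the
cell `#{p : v_p(abc) ≥ 5} ≤ 1` with SOME exponent `4 − δ < 4` (`δ = min(η,1)/8`).  The proof of
`stub_cellOneOfUniformQuarticThueMahler`, the hypotheses being applied only to the datum read off a triple of the
cell, whose cell hypothesis is that of the triple. [folklore] -/
theorem cellOneIffUQTM_of_cell : ∀ η : ℝ, 0 < η →
    (∃ B : ℕ, ∀ a u v p k Z : ℕ, p.Prime → 0 < a → 0 < u → 0 < v → 0 < Z →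
        a + p ^ k * u = v * Z ^ 4 → Nat.Coprime (p ^ k * u) (v * Z ^ 4) →
        ((a * (p ^ k * u) * (v * Z ^ 4)).primeFactors.filter
            (fun q => 5 ≤ (a * (p ^ k * u) * (v * Z ^ 4)).factorization q)).card ≤ 1 →
        ((a * u * v * p : ℕ) : ℝ) ≤ (Z : ℝ) ^ η → Z ≤ B) →
    (∃ B : ℕ, ∀ a u v p w Y : ℕ, p.Prime → 0 < a → 0 < u → 0 < v → 0 < Y →
        a + u * Y ^ 4 = p ^ w * v → Nat.Coprime (u * Y ^ 4) (p ^ w * v) →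
        ((a * (u * Y ^ 4) * (p ^ w * v)).primeFactors.filter
            (fun q => 5 ≤ (a * (u * Y ^ 4) * (p ^ w * v)).factorization q)).card ≤ 1 →
        ((a * u * v * p : ℕ) : ℝ) ≤ (Y : ℝ) ^ η → Y ≤ B) →
    ∃ δ : ℝ, 0 < δ ∧ ∃ C : ℝ, 0 < C ∧ ∀ a b c : ℕ,
      Literature.NumberTheory.DiophantineGeometry.IsABCTriple a b c →
      ((a * b * c).primeFactors.filter (fun p => 5 ≤ (a * b * c).factorization p)).card ≤ 1 →
      (c : ℝ) < C * ((Literature.NumberTheory.DiophantineGeometry.rad a b c : ℕ) : ℝ) ^ (4 - δ) := by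
  -- adapted from `stub_cellOneOfUniformQuarticThueMahler` (`…StubCellOneThueMahler`)
  rintro η hη ⟨B₁, hB1⟩ ⟨B₂, hB2⟩
  -- pass to `η' = min η 1`
  set η' : ℝ := min η 1 with hη'
  have hη'pos : 0 < η' := lt_min hη one_pos
  have hη'le : η' ≤ η := min_le_left _ _
  have hη'le1 : η' ≤ 1 := min_le_right _ _
  set R₀ : ℝ := 4 * (B₁ : ℝ) ^ 2 + 4 * (B₂ : ℝ) ^ 2 + (32 : ℝ) ^ (8 / (3 * η')) with hR₀
  have hT : (0 : ℝ) < (32 : ℝ) ^ (8 / (3 * η')) := Real.rpow_pos_of_pos (by norm_num) _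
  have hR₀0 : (0 : ℝ) ≤ R₀ := by positivity
  have hR₀4 : (0 : ℝ) ≤ R₀ ^ 4 := by positivity
  refine ⟨η' / 8, by positivity, 2 * R₀ ^ 4 + 2, by positivity, ?_⟩
  intro a b c habc hK
  -- WLOG `a ≤ b`
  wlog hab : a ≤ b generalizing a b with H
  · have hsw : IsABCTriple b a c :=
      ⟨habc.2.1, habc.1, by rw [add_comm]; exact habc.2.2.1, habc.2.2.2.symm⟩
    have hprod : b * a * c = a * b * c := by ring
    have hK' : ((b * a * c).primeFactors.filter (fun p => 5 ≤ (b * a * c).factorization p)).card ≤ 1 := by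
      rw [hprod]; exact hK
    have := H b a hsw hK' (le_of_not_ge hab)
    rwa [rad_def, hprod, ← rad_def] at this
  set R := rad a b c with hR
  have hR1nat : 1 ≤ R := by rw [hR, rad_def]; exact Nat.radical_pos _
  have hx1 : (1 : ℝ) ≤ (R : ℝ) := by exact_mod_cast hR1nat
  have hx0 : (0 : ℝ) < (R : ℝ) := by linarith
  have hpow1 : (1 : ℝ) ≤ (R : ℝ) ^ (4 - η' / 8) := Real.one_le_rpow hx1 (by linarith)
  have hpow0 : (0 : ℝ) ≤ (R : ℝ) ^ (4 - η' / 8) := by linarith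
  have hcalR : (c : ℝ) ≤ 2 * (R : ℝ) ^ 4 := by exact_mod_cast calibration_one a b c habc hK
  have hc : 0 < c := by have := habc.2.2.1; have := habc.1; omega
  rcases stub_cellOneCases a b c habc hab hK with hlt | hrest
  · -- `c < 2R² ≤ 2R^(4−δ)`
    have h1 : (c : ℝ) < 2 * (R : ℝ) ^ 2 := by exact_mod_cast hlt
    have hpow2 : (R : ℝ) ^ (2 : ℕ) ≤ (R : ℝ) ^ (4 - η' / 8) := by
      calc (R : ℝ) ^ (2 : ℕ) = (R : ℝ) ^ ((2 : ℕ) : ℝ) := (Real.rpow_natCast _ 2).symm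
        _ ≤ (R : ℝ) ^ (4 - η' / 8) := Real.rpow_le_rpow_of_exponent_le hx1 (by push_cast; linarith)
    calc (c : ℝ) < 2 * (R : ℝ) ^ 2 := h1
      _ ≤ 2 * (R : ℝ) ^ (4 - η' / 8) := by linarith
      _ ≤ (2 * R₀ ^ 4 + 2) * (R : ℝ) ^ (4 - η' / 8) := mul_le_mul_of_nonneg_right (by linarith) hpow0
  -- a non-exceptional triple satisfies the bound outright
  by_cases hexc : (R : ℝ) ^ (4 - η' / 8) ≤ (c : ℝ)
  swap
  · calc (c : ℝ) < (R : ℝ) ^ (4 - η' / 8) := not_le.mp hexc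
      _ = 1 * (R : ℝ) ^ (4 - η' / 8) := (one_mul _).symm
      _ ≤ (2 * R₀ ^ 4 + 2) * (R : ℝ) ^ (4 - η' / 8) := mul_le_mul_of_nonneg_right (by linarith) hpow0
  -- an exceptional triple has `R ≤ R₀`, hence `c ≤ 2R⁴ < C`
  suffices hRR₀ : (R : ℝ) ≤ R₀ by
    have hR4 : (R : ℝ) ^ 4 ≤ R₀ ^ 4 := pow_le_pow_left₀ hx0.le hRR₀ 4
    calc (c : ℝ) ≤ 2 * (R : ℝ) ^ 4 := hcalR
      _ < 2 * R₀ ^ 4 + 2 := by linarith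
      _ = (2 * R₀ ^ 4 + 2) * 1 := (mul_one _).symm
      _ ≤ (2 * R₀ ^ 4 + 2) * (R : ℝ) ^ (4 - η' / 8) := mul_le_mul_of_nonneg_left hpow1 (by positivity)
  have hBB : (0 : ℝ) ≤ 4 * (B₁ : ℝ) ^ 2 + 4 * (B₂ : ℝ) ^ 2 := by positivity
  -- small radical: `R^(3η'/8) < 32`
  by_cases hbig : (32 : ℝ) ≤ (R : ℝ) ^ (3 * η' / 8)
  swap
  · push Not at hbig
    have h1 : ((R : ℝ) ^ (3 * η' / 8)) ^ (8 / (3 * η')) < (32 : ℝ) ^ (8 / (3 * η')) :=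
      Real.rpow_lt_rpow (Real.rpow_nonneg hx0.le _) hbig (by positivity)
    have h2 : ((R : ℝ) ^ (3 * η' / 8)) ^ (8 / (3 * η')) = (R : ℝ) := by
      rw [← Real.rpow_mul hx0.le]
      have : 3 * η' / 8 * (8 / (3 * η')) = 1 := by field_simp
      rw [this, Real.rpow_one]
    rw [h2] at h1
    rw [hR₀]; linarith
  have hB₁0 : (0 : ℝ) ≤ 4 * (B₁ : ℝ) ^ 2 := by positivity
  have hB₂0 : (0 : ℝ) ≤ 4 * (B₂ : ℝ) ^ 2 := by positivity
  rcases hrest with ⟨p, k, u, v, Z, hp, hu, hv, hZ, heq, hcopr, hcvZ, hN5, hN6⟩ |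
    ⟨p, w, u, v, Y, hp, hu, hv, hY, heq, hcopr, hbuY, hc2b, hN5, hN6⟩
  · -- deep prime in `b`: the cell hypothesis of the datum is that of the triple, as `b = p^k·u`, `c = v·Z⁴`
    have hbpu : b = p ^ k * u := Nat.add_left_cancel (habc.2.2.1.trans (hcvZ.trans heq.symm))
    have hK1 : ((a * (p ^ k * u) * (v * Z ^ 4)).primeFactors.filter
        (fun q => 5 ≤ (a * (p ^ k * u) * (v * Z ^ 4)).factorization q)).card ≤ 1 := by
      rw [← hbpu, ← hcvZ]; exact hK
    have hZ1 : (1 : ℝ) ≤ (Z : ℝ) := by exact_mod_cast hZ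
    have hcc : c ≤ 2 * c := by omega
    have hRB := cellOneIffUQTM_radius hη'pos hη'le1 hZ hcc hN5 hN6 hR1nat hc hexc hbig (fun hle =>
      hB1 a u v p k Z hp habc.1 hu hv hZ heq hcopr hK1 (hle.trans (Real.rpow_le_rpow_of_exponent_le hZ1 hη'le)))
    rw [hR₀]; linarith
  · -- deep prime in `c`: the cell hypothesis of the datum is that of the triple, as `b = u·Y⁴`, `c = p^w·v`
    have hcpv : c = p ^ w * v := by rw [← heq, ← hbuY]; exact habc.2.2.1.symm
    have hK2 : ((a * (u * Y ^ 4) * (p ^ w * v)).primeFactors.filter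
        (fun q => 5 ≤ (a * (u * Y ^ 4) * (p ^ w * v)).factorization q)).card ≤ 1 := by
      rw [← hbuY, ← hcpv]; exact hK
    have hY1 : (1 : ℝ) ≤ (Y : ℝ) := by exact_mod_cast hY
    have hRB := cellOneIffUQTM_radius hη'pos hη'le1 hY hc2b hN5 hN6 hR1nat habc.2.1 hexc hbig (fun hle =>
      hB2 a u v p w Y hp habc.1 hu hv hY heq hcopr hK2 (hle.trans (Real.rpow_le_rpow_of_exponent_le hY1 hη'le)))
    rw [hR₀]; linarith

/-- **The core of the `→` half:** if abc holds with exponent `4 − δ` on the cell and `η·(4 − δ) < δ`, then an abc triple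
`(a, b, c)` of the cell with `rad(abc) ≤ M·X`, `M ≤ X^η` and `X⁴ ≤ c` has `X ≤ ⌊C^(1/κ)⌋ + ⌊C⌋`, `κ = δ − η(4−δ)`:
indeed `X⁴ ≤ c < C·rad^(4−δ) ≤ C·X^((1+η)(4−δ)) = C·X^(4−κ)` if `δ ≤ 4`, and `X ≤ c < C` if `δ > 4`. [folklore] -/
theorem cellOneIffUQTM_bound {δ C η : ℝ} (hC : 0 < C) (hκ : η * (4 - δ) < δ)
    (h : ∀ a b c : ℕ, IsABCTriple a b c →
      ((a * b * c).primeFactors.filter (fun p => 5 ≤ (a * b * c).factorization p)).card ≤ 1 →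
      (c : ℝ) < C * ((rad a b c : ℕ) : ℝ) ^ (4 - δ))
    {a b c M X : ℕ} (habc : IsABCTriple a b c)
    (hcell : ((a * b * c).primeFactors.filter (fun p => 5 ≤ (a * b * c).factorization p)).card ≤ 1)
    (hX : 0 < X) (hrad : rad a b c ≤ M * X) (hM : ((M : ℕ) : ℝ) ≤ (X : ℝ) ^ η) (hXc : X ^ 4 ≤ c) :
    X ≤ ⌊C ^ (1 / (δ - η * (4 - δ)))⌋₊ + ⌊C⌋₊ := by
  -- adapted from `stub_uniformQuarticThueOfCellZero` (`…StubQuarticThueOfCellZero`)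
  have hlt := h a b c habc hcell
  set R : ℕ := rad a b c with hR
  have hR1 : (1 : ℝ) ≤ (R : ℝ) := by
    have : 1 ≤ R := by rw [hR, rad_def]; exact Nat.radical_pos _
    exact_mod_cast this
  have hX1 : (1 : ℝ) ≤ (X : ℝ) := by exact_mod_cast hX
  have hX0 : (0 : ℝ) < (X : ℝ) := by linarith
  have hXcR : (X : ℝ) ^ (4 : ℕ) ≤ (c : ℝ) := by exact_mod_cast hXc
  by_cases hδ4 : δ ≤ 4
  · -- main case `0 ≤ 4 − δ`: `X^4 < C·X^(4−κ)`
    set κ : ℝ := δ - η * (4 - δ) with hκdef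
    have hκpos : 0 < κ := by rw [hκdef]; linarith
    have hRX : (R : ℝ) ≤ (X : ℝ) ^ (1 + η) := by
      have h1 : (R : ℝ) ≤ (M : ℝ) * (X : ℝ) := by exact_mod_cast hrad
      have h2 : (M : ℝ) * (X : ℝ) ≤ (X : ℝ) ^ η * (X : ℝ) := mul_le_mul_of_nonneg_right hM hX0.le
      have h3 : (X : ℝ) ^ η * (X : ℝ) = (X : ℝ) ^ (1 + η) := by
        rw [Real.rpow_add hX0, Real.rpow_one, mul_comm]
      linarith
    have hRpow : (R : ℝ) ^ (4 - δ) ≤ (X : ℝ) ^ (4 - κ) :=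
      calc (R : ℝ) ^ (4 - δ) ≤ ((X : ℝ) ^ (1 + η)) ^ (4 - δ) :=
            Real.rpow_le_rpow (by positivity) hRX (by linarith)
        _ = (X : ℝ) ^ (4 - κ) := by rw [← Real.rpow_mul hX0.le]; congr 1; rw [hκdef]; ring
    have hX4lt : (X : ℝ) ^ (4 : ℕ) < C * (X : ℝ) ^ (4 - κ) :=
      calc (X : ℝ) ^ (4 : ℕ) ≤ (c : ℝ) := hXcR
        _ < C * (R : ℝ) ^ (4 - δ) := hlt
        _ ≤ C * (X : ℝ) ^ (4 - κ) := mul_le_mul_of_nonneg_left hRpow hC.le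
    have hsplit : (X : ℝ) ^ (4 : ℕ) = (X : ℝ) ^ κ * (X : ℝ) ^ (4 - κ) := by
      rw [← Real.rpow_add hX0, ← Real.rpow_natCast (X : ℝ) 4]; congr 1; push_cast; ring
    have hXκ : (X : ℝ) ^ κ < C := by
      rw [hsplit] at hX4lt
      exact lt_of_mul_lt_mul_right hX4lt (Real.rpow_nonneg hX0.le _)
    have hXlt : (X : ℝ) < C ^ (1 / κ) := by
      have h1 : ((X : ℝ) ^ κ) ^ (1 / κ) < C ^ (1 / κ) :=
        Real.rpow_lt_rpow (Real.rpow_nonneg hX0.le _) hXκ (by positivity)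
      rwa [← Real.rpow_mul hX0.le, mul_one_div_cancel hκpos.ne', Real.rpow_one] at h1
    have := nat_le_floor_of_lt hXlt
    omega
  · -- degenerate case `δ > 4`: the hypothesis already bounds `c` by `C`
    push Not at hδ4
    have hRpow : (R : ℝ) ^ (4 - δ) ≤ 1 := Real.rpow_le_one_of_one_le_of_nonpos hR1 (by linarith)
    have hXC : (X : ℝ) < C :=
      calc (X : ℝ) ≤ (X : ℝ) ^ (4 : ℕ) := le_self_pow₀ hX1 (by norm_num)
        _ ≤ (c : ℝ) := hXcR
        _ < C * (R : ℝ) ^ (4 - δ) := hlt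
        _ ≤ C * 1 := mul_le_mul_of_nonneg_left hRpow hC.le
        _ = C := mul_one C
    have := nat_le_floor_of_lt hXC
    omega

/-- **Stub `stub_cellOneIffUniformQuarticThueMahlerCell` (c23 wave 3) of line `Sketch`, crux `DepthCountedABC`
(stmt-ABC-14938):** on the cell `#{p : v_p(abc) ≥ 5} ≤ 1`, abc with SOME exponent `4 − δ < 4` is EQUIVALENT to the
uniform binomial quartic Thue–Mahler statement on the cell — for some `η > 0`, bounded `Z` over the positive coprime
solutions of `a + p^k·u = v·Z⁴` in the cell with `a·u·v·p ≤ Z^η` and bounded `Y` over those of `a + u·Y⁴ = p^w·v` in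
the cell with `a·u·v·p ≤ Y^η` (`p` prime).  `→` is `cellOneIffUQTM_bound` at `η = δ/8` on the triples
`(a, p^k u, v Z⁴)`, `(a, u Y⁴, p^w v)`; `←` is `cellOneIffUQTM_of_cell`. [folklore] -/
theorem stub_cellOneIffUniformQuarticThueMahlerCell :
    (∃ δ : ℝ, 0 < δ ∧ ∃ C : ℝ, 0 < C ∧ ∀ a b c : ℕ,
      Literature.NumberTheory.DiophantineGeometry.IsABCTriple a b c →
      ((a * b * c).primeFactors.filter (fun p => 5 ≤ (a * b * c).factorization p)).card ≤ 1 →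
      (c : ℝ) < C * ((Literature.NumberTheory.DiophantineGeometry.rad a b c : ℕ) : ℝ) ^ (4 - δ)) ↔
    (∃ η : ℝ, 0 < η ∧
      (∃ B : ℕ, ∀ a u v p k Z : ℕ, p.Prime → 0 < a → 0 < u → 0 < v → 0 < Z →
        a + p ^ k * u = v * Z ^ 4 → Nat.Coprime (p ^ k * u) (v * Z ^ 4) →
        ((a * (p ^ k * u) * (v * Z ^ 4)).primeFactors.filter
            (fun q => 5 ≤ (a * (p ^ k * u) * (v * Z ^ 4)).factorization q)).card ≤ 1 →
        ((a * u * v * p : ℕ) : ℝ) ≤ (Z : ℝ) ^ η → Z ≤ B) ∧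
      (∃ B : ℕ, ∀ a u v p w Y : ℕ, p.Prime → 0 < a → 0 < u → 0 < v → 0 < Y →
        a + u * Y ^ 4 = p ^ w * v → Nat.Coprime (u * Y ^ 4) (p ^ w * v) →
        ((a * (u * Y ^ 4) * (p ^ w * v)).primeFactors.filter
            (fun q => 5 ≤ (a * (u * Y ^ 4) * (p ^ w * v)).factorization q)).card ≤ 1 →
        ((a * u * v * p : ℕ) : ℝ) ≤ (Y : ℝ) ^ η → Y ≤ B)) := by
  constructor
  · rintro ⟨δ, hδ, C, hC, h⟩
    -- `η = δ/8`: `η·(4 − δ) = δ/2 − δ²/8 < δ`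
    have hκ : δ / 8 * (4 - δ) < δ := by nlinarith [sq_nonneg δ]
    refine ⟨δ / 8, by positivity,
      ⟨⌊C ^ (1 / (δ - δ / 8 * (4 - δ)))⌋₊ + ⌊C⌋₊, fun a u v p k Z hp ha hu hv hZ hsum hcop hcell hle => ?_⟩,
      ⟨⌊C ^ (1 / (δ - δ / 8 * (4 - δ)))⌋₊ + ⌊C⌋₊, fun a u v p w Y hp ha hu hv hY hsum hcop hcell hle => ?_⟩⟩
    · -- first shape: the abc triple `(a, p^k u, v Z⁴)` of the cell, `rad ≤ (a u v p)·Z`, `Z⁴ ≤ c`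
      have hp0 : 0 < p := hp.pos
      have habc : IsABCTriple a (p ^ k * u) (v * Z ^ 4) :=
        ⟨ha, by positivity, hsum, thueMahlerOfCellOneLittleO_coprime_of_sum hsum hcop⟩
      have hrad : rad a (p ^ k * u) (v * Z ^ 4) ≤ a * u * v * p * Z :=
        calc rad a (p ^ k * u) (v * Z ^ 4) ≤ a * (p * u) * (v * Z) :=
              thueMahlerOfCellOneLittleO_rad_le_mul₃ (Nat.radical_le_self_iff.mpr ha.ne')
                (thueMahlerOfCellOneLittleO_radical_prime_pow_mul_le hp hu) (radical_mul_pow_four_le hv hZ)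
          _ = a * u * v * p * Z := by ring
      exact cellOneIffUQTM_bound hC hκ h habc hcell hZ hrad hle (Nat.le_mul_of_pos_left _ hv)
    · -- second shape: the abc triple `(a, u Y⁴, p^w v)` of the cell, `rad ≤ (a u v p)·Y`, `Y⁴ ≤ u Y⁴ ≤ c`
      have hp0 : 0 < p := hp.pos
      have habc : IsABCTriple a (u * Y ^ 4) (p ^ w * v) :=
        ⟨ha, by positivity, hsum, thueMahlerOfCellOneLittleO_coprime_of_sum hsum hcop⟩
      have hrad : rad a (u * Y ^ 4) (p ^ w * v) ≤ a * u * v * p * Y :=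
        calc rad a (u * Y ^ 4) (p ^ w * v) ≤ a * (u * Y) * (p * v) :=
              thueMahlerOfCellOneLittleO_rad_le_mul₃ (Nat.radical_le_self_iff.mpr ha.ne')
                (radical_mul_pow_four_le hu hY) (thueMahlerOfCellOneLittleO_radical_prime_pow_mul_le hp hv)
          _ = a * u * v * p * Y := by ring
      have hY4 : Y ^ 4 ≤ p ^ w * v :=
        calc Y ^ 4 ≤ u * Y ^ 4 := Nat.le_mul_of_pos_left _ hu
          _ ≤ a + u * Y ^ 4 := Nat.le_add_left _ _
          _ = p ^ w * v := hsum
      exact cellOneIffUQTM_bound hC hκ h habc hcell hY hrad hle hY4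
  · rintro ⟨η, hη, hB, hB'⟩
    exact cellOneIffUQTM_of_cell η hη hB hB'

end Summit.ABC.ABC.Theorems.DepthCountedABC
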